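/-
Origin: expansion seat `planner-pub-hodgecm-pv11-g4-0`, handover #5 2026-08-18T07:10:46Z (`HOME/pub-hodgecm-pv11-g4/lean/Pv11g4/NormOneRelTorusCircles.lean`, md5 c645acab, 151 lines);
landed by the gen-7 packager in gate run 25 as `HodgeCM/PerL34/NormOneRelTorusCircles.lean` (import ^import Pv[0-9]+g[0-9]+\.→import HodgeCM.PerL34. ×1).
-/
/-
Origin: expansion seat `planner-pub-hodgecm-pv11-g4-0` (unit `pub-hodgecm-pv11-g4`, DAG-NODE PROVER #11 gen 4), HodgeCM publication
cell, 2026-08-18.  WIP module `Pv11g4.NormOneRelTorusCircles`; intended landing `HodgeCM/PerL34/NormOneRelTorusCircles.lean`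
(one import rewrite: `Pv11g4.NormOneRelTorusWeights` ↦ `HodgeCM.PerL34.NormOneRelTorusWeights`).
-/
import Summits.HodgeConjecture.HodgeCM.PerL34.NormOneRelTorusWeights

/-!
# `U(W_j)(L₀ ⊗ ℝ) ≅ ∏_w U(1)`: the archimedean torus of a CM hermitian line is a product of circles

File `NormOneRelTorusWeights` embeds the archimedean torus `unitaryLineArchTorus L = {y ∈ L_∞^× : y ȳ = 1}` of a CM field
`L` into `∏_{w ∣ ∞} U(1)` by the weight characters `y ↦ (ι_w(y_w))_w`.  Here we prove the embedding is ONTO, i.e.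

* `NumberField.archPlaceChars_surjective`, and the resulting isomorphism of topological groups
  `NumberField.unitaryLineArchTorusEquiv L : unitaryLineArchTorus L ≃* (InfinitePlace L → Circle)`,
  `NumberField.unitaryLineArchTorusHomeomorph L : _ ≃ₜ _` (continuous bijection, compact → Hausdorff) and
  `NumberField.unitaryLineArchTorusContinuousMulEquiv L : unitaryLineArchTorus L ≃ₜ* (InfinitePlace L → Circle)`.

The one piece of mathematics is the compatibility of the Galois transport with complex conjugation of `ℂ`:
for a CM field, `ι_w (c̄_w t) = conj (ι_w t)` on `L_w` (`extensionEmbedding_galInfiniteCompletionMap_complexConj`;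
by density from Mathlib's `IsCMField.complexEmbedding_complexConj : φ (c x) = conj (φ x)`), together with the formula
`(c • x)_w = c̄_w (x_w)` (`InfiniteAdeleRing.complexConj_smul_apply`, the place `w` being fixed by `c`).  Every infinite
place of a CM field is complex, so `ι_w : L_w ≃ ℂ` (Mathlib `ringEquivComplexOfIsComplex`) and a family `(z_w)_w` of unit
complex numbers lifts to `y = (ι_w⁻¹ z_w)_w`, which satisfies `y ȳ = 1`.  Pure construction/proof; nothing cited or posited.
-/

set_option autoImplicit false

noncomputable section

open Topology Set Function

namespace NumberField

open IsDedekindDomain InfinitePlace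
open Literature.NumberTheory Literature.NumberTheory.Automorphic

section Circles

variable (L : Type) [Field L] [NumberField L] [IsCMField L]

/-- `(c • x)_w = c̄_w (x_w)`: the `w`-component of the conjugate of an infinite adele is the Galois transport (along
`c • w = w`) of its `w`-component. -/
theorem InfiniteAdeleRing.complexConj_smul_apply (x : InfiniteAdeleRing L) (w : InfinitePlace L) :
    (IsCMField.complexConj L • x) w =
      galInfiniteCompletionMap (IsCMField.complexConj L) (complexConj_smul_infinitePlace L w) (x w) := by
  rw [InfiniteAdeleRing.smul_apply]
  exact galInfiniteCompletionMap_apply_congr_place (maximalRealSubfield L)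
    (by rw [inv_smul_eq_iff, complexConj_smul_infinitePlace]) _ _ x

/-- **`ι_w ∘ c̄_w = conj ∘ ι_w`**: under the embedding `L_w →+* ℂ` the Galois transport of complex conjugation of the
CM field `L` is complex conjugation of `ℂ`. -/
theorem extensionEmbedding_galInfiniteCompletionMap_complexConj (w : InfinitePlace L) (t : w.Completion) :
    Completion.extensionEmbedding w
        (galInfiniteCompletionMap (IsCMField.complexConj L) (complexConj_smul_infinitePlace L w) t) =
      starRingEnd ℂ (Completion.extensionEmbedding w t) := by
  refine congrFun (InfinitePlace.Completion.ext_of_coe w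
    ((Completion.isometry_extensionEmbedding w).continuous.comp
      (continuous_galInfiniteCompletionMap (maximalRealSubfield L) _ _))
    (Complex.continuous_conj.comp (Completion.isometry_extensionEmbedding w).continuous) fun x => ?_) t
  simp only [Function.comp_apply, galInfiniteCompletionMap_coe]
  change Completion.extensionEmbedding w (((WithAbs.equiv w.1).symm (IsCMField.complexConj L x) : WithAbs w.1)) =
    starRingEnd ℂ (Completion.extensionEmbedding w (((WithAbs.equiv w.1).symm x : WithAbs w.1)))
  rw [Completion.extensionEmbedding_coe, Completion.extensionEmbedding_coe, RingEquiv.apply_symm_apply,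
    RingEquiv.apply_symm_apply]
  exact IsCMField.complexEmbedding_complexConj L w.embedding x

/-- `ι_w ((c • x)_w) = conj (ι_w (x_w))`. -/
theorem extensionEmbedding_complexConj_smul_apply (x : InfiniteAdeleRing L) (w : InfinitePlace L) :
    Completion.extensionEmbedding w ((IsCMField.complexConj L • x) w) =
      starRingEnd ℂ (Completion.extensionEmbedding w (x w)) := by
  rw [InfiniteAdeleRing.complexConj_smul_apply, extensionEmbedding_galInfiniteCompletionMap_complexConj]

/-- Every infinite place of the CM field `L` is complex, so `ι_w : L_w ≃+* ℂ`. -/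
def placeEquivComplex (w : InfinitePlace L) : w.Completion ≃+* ℂ :=
  Completion.ringEquivComplexOfIsComplex (IsTotallyComplex.isComplex w)

/-- (Ported verbatim from the HodgeCMPerL package; no docstring in the source.) -/
@[simp] theorem placeEquivComplex_apply (w : InfinitePlace L) (t : w.Completion) :
    placeEquivComplex L w t = Completion.extensionEmbedding w t := rfl

/-- The lift of a family of unit complex numbers to an infinite idele: `y_w = ι_w⁻¹ (z_w)`. -/
def liftCircles (z : InfinitePlace L → Circle) : (InfiniteAdeleRing L)ˣ where
  val := fun w => (placeEquivComplex L w).symm (z w)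
  inv := fun w => (placeEquivComplex L w).symm ((z w)⁻¹ : Circle)
  val_inv := by
    funext w
    change (placeEquivComplex L w).symm (z w) * (placeEquivComplex L w).symm ((z w)⁻¹ : Circle) = 1
    rw [← map_mul, ← Circle.coe_mul, mul_inv_cancel, Circle.coe_one, map_one]
  inv_val := by
    funext w
    change (placeEquivComplex L w).symm ((z w)⁻¹ : Circle) * (placeEquivComplex L w).symm (z w) = 1
    rw [← map_mul, ← Circle.coe_mul, inv_mul_cancel, Circle.coe_one, map_one]

/-- (Ported verbatim from the HodgeCMPerL package; no docstring in the source.) -/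
theorem liftCircles_apply (z : InfinitePlace L → Circle) (w : InfinitePlace L) :
    ((liftCircles L z : (InfiniteAdeleRing L)ˣ) : InfiniteAdeleRing L) w = (placeEquivComplex L w).symm (z w) := rfl

/-- (Ported verbatim from the HodgeCMPerL package; no docstring in the source.) -/
theorem extensionEmbedding_liftCircles (z : InfinitePlace L → Circle) (w : InfinitePlace L) :
    Completion.extensionEmbedding w (((liftCircles L z : (InfiniteAdeleRing L)ˣ) : InfiniteAdeleRing L) w) = z w := by
  rw [liftCircles_apply, ← placeEquivComplex_apply, RingEquiv.apply_symm_apply]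

/-- The lift lies in the archimedean torus: `y ȳ = 1`. -/
theorem liftCircles_mem (z : InfinitePlace L → Circle) : liftCircles L z ∈ unitaryLineArchTorus L := by
  rw [unitaryLineArchTorus, mem_relNormOneInfUnits_iff_mul_conj]
  apply Units.ext
  funext w
  change ((liftCircles L z : (InfiniteAdeleRing L)ˣ) : InfiniteAdeleRing L) w *
      (IsCMField.complexConj L • ((liftCircles L z : (InfiniteAdeleRing L)ˣ) : InfiniteAdeleRing L)) w = 1
  apply (Completion.extensionEmbedding w).injective
  rw [map_mul, extensionEmbedding_complexConj_smul_apply, extensionEmbedding_liftCircles, map_one,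
    ← Circle.coe_inv_eq_conj, ← Circle.coe_mul, mul_inv_cancel, Circle.coe_one]

/-- **The weight characters are jointly onto**: every family of unit complex numbers is realised. -/
theorem archPlaceChars_surjective : Function.Surjective (archPlaceChars L) := by
  intro z
  refine ⟨⟨liftCircles L z, liftCircles_mem L z⟩, funext fun w => Circle.ext ?_⟩
  rw [archPlaceChars_apply, coe_archPlaceChar]
  exact extensionEmbedding_liftCircles L z w

/-- (Ported verbatim from the HodgeCMPerL package; no docstring in the source.) -/
theorem archPlaceChars_bijective : Function.Bijective (archPlaceChars L) :=
  ⟨archPlaceChars_injective L, archPlaceChars_surjective L⟩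

/-- **`U(W_j)(L₀ ⊗ ℝ) ≅ ∏_{w ∣ ∞} U(1)`** as groups (for a hermitian line over a CM extension). -/
def unitaryLineArchTorusEquiv : unitaryLineArchTorus L ≃* (InfinitePlace L → Circle) :=
  MulEquiv.ofBijective (archPlaceChars L) (archPlaceChars_bijective L)

/-- (Ported verbatim from the HodgeCMPerL package; no docstring in the source.) -/
@[simp] theorem unitaryLineArchTorusEquiv_apply (y : unitaryLineArchTorus L) :
    unitaryLineArchTorusEquiv L y = archPlaceChars L y := rfl

/-- (Ported verbatim from the HodgeCMPerL package; no docstring in the source.) -/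
theorem continuous_unitaryLineArchTorusEquiv : Continuous (unitaryLineArchTorusEquiv L) :=
  continuous_archPlaceChars L

/-- … and as topological groups: the continuous bijection from the compact torus onto the Hausdorff product of circles
is a homeomorphism. -/
def unitaryLineArchTorusHomeomorph : unitaryLineArchTorus L ≃ₜ (InfinitePlace L → Circle) :=
  Continuous.homeoOfEquivCompactToT2 (f := (unitaryLineArchTorusEquiv L).toEquiv)
    (continuous_unitaryLineArchTorusEquiv L)

/-- (Ported verbatim from the HodgeCMPerL package; no docstring in the source.) -/
@[simp] theorem unitaryLineArchTorusHomeomorph_apply (y : unitaryLineArchTorus L) :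
    unitaryLineArchTorusHomeomorph L y = archPlaceChars L y := rfl

/-- `U(W_j)(L₀ ⊗ ℝ) ≅ ∏_w U(1)` as topological groups (a `ContinuousMulEquiv`). -/
def unitaryLineArchTorusContinuousMulEquiv : unitaryLineArchTorus L ≃ₜ* (InfinitePlace L → Circle) :=
  { unitaryLineArchTorusEquiv L with
    continuous_toFun := (unitaryLineArchTorusHomeomorph L).continuous
    continuous_invFun := (unitaryLineArchTorusHomeomorph L).symm.continuous }

end Circles

end NumberField

end
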